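import Summits.QuantumAdvantage.QuantumAdvantage.Theorems.WhiteBoxWalkWbwObfuscatedGluedTreesGenerator

/-!
# Line `knowledge-of-walk-split`, STAGE 3 — the knowledge-free residual `ClearHardness`
# (crux `WbwObfuscatedGluedTrees`, stmt-QuantumAdvantage-2340, route WhiteBoxWalk)

Lead prover-line-stmt-QuantumAdvantage-2340-c2-0 (2026-08-17), continuing the line of leads -0 / -1.

Stages 1–2 (`knowledgeTransfer_holds`, `generatorTransfer_holds`, `typedCrux_holds`) carry the knowledge-of-walk axiom
KWA₀ in the residual hypothesis `ReferenceHardness` (= KWA₀ ∧ WordHard₀ for SOME admissible reference presentation).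
But the stage-1 composition uses KWA₀ and WordHard₀ ONLY through `stub_split`, to obtain clause (C) for the CLEAR reference
generator; the two other stubs (`obfuscationMonotone`, `bestPossibleStep`) then transfer "(C) in the clear" to "(C) for
`iO(N_K)`".  This file names the weaker, knowledge-free residual and re-derives the typed crux from it:

* `ClearTransfer` / `clearTransfer_holds` — stage 1 without the split: for every admissible line datum and sub-exp iO `O`,
  `ClauseC 𝓛.gen₀ 𝓛.answer → ClauseC (𝓛.gen O) 𝓛.answer` (stubs 2–3 by name).
* `GeneratorClearTransfer` / `generatorClearTransfer_holds` — the same on the landed generator (stubs of stage 2 by name).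
* `ClearHardness D O P` — SOME admissible reference presentation `Γ₁` has clause (C) IN THE CLEAR:
  `ClauseC (D.lineData Γ₁ P).gen₀ (D.lineData Γ₁ P).answer`.  This is the best-possible-obfuscation residue of the crux:
  "does ANY equal-size presentation of the neighbour circuits hide the EXIT from classical white-box walkers?".
* `clearHardness_of_referenceHardness` — `ReferenceHardness → ClearHardness` (under `GenAdmissible`, by `stub_split` and
  `stub_coherent`): the new residual is WEAKER (no knowledge axiom).
* `TypedCruxClear` / `typedCruxClear_holds` — the typed crux with `ClearHardness` as antecedent, PROVED; and
  `typedCrux_of_typedCruxClear : TypedCruxClear → TypedCrux`.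
* `ResidualConjectureClear`, `residualConjectureClear_of_residualConjecture`, `wbwEngine_of_residualConjectureClear` —
  the route's engine `WbwEngine` now holds modulo the knowledge-free residual alone.

No hardness is asserted; `ClearHardness` is a hypothesis of the route (crux-grade), never a fact.
-/

set_option linter.dupNamespace false

namespace Summit.QuantumAdvantage.QuantumAdvantage.Cruxes.WbwObfuscatedGluedTrees.KnowledgeOfWalkSplit.Generator

open Literature.Computability.Cryptography Literature.Computability.Complexity Filter Asymptotics
open Literature.Computability.Cryptography.ObfuscatedGluedTrees
open Literature.Computability.QuantumComplexity
open Summit.QuantumAdvantage.QuantumAdvantage.Theorems.WbwObfuscatedGluedTrees.Negative (ClauseC GenType CruxShape)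
open Summit.QuantumAdvantage.QuantumAdvantage.Theorems.WbwObfuscatedGluedTrees.KnowledgeOfWalk
  (WalkModel inst KnowledgeOfWalk WordHard Coherent genObf genClear keyed)
open Summit.QuantumAdvantage.QuantumAdvantage.Theorems.WbwObfuscatedGluedTrees.KnowledgeOfWalk.Generator
open Summit.QuantumAdvantage.QuantumAdvantage.Cruxes.WbwObfuscatedGluedTrees.KnowledgeOfWalkSplit
  (LineData KnowledgeTransfer knowledgeTransfer_holds obfuscationMonotone_holds bestPossibleStep_holds splitLemma_holds)

/-! ## §1 Stage 1 without the split: (C) in the clear transfers to (C) for the obfuscated generator -/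

/-- **Clear transfer** (stage 1 minus `stub_split`): for every line datum admissible for a sub-exponentially secure
iO `O`, clause (C) for the CLEAR reference generator `𝓛.gen₀ = ⟨code of C₁ k, nm k⟩` implies clause (C) for the
crux-shaped generator `𝓛.gen O = ⟨code of O(κ, C₀ k; coins), nm k⟩`. -/
def ClearTransfer : Prop :=
  ∀ (𝓛 : LineData) (ε : ℝ) (O : CircuitObfuscator), 0 < ε → IsSubexpIO ε ppolyCircuits O →
    𝓛.Admissible O → ClauseC 𝓛.gen₀ 𝓛.answer → ClauseC (𝓛.gen O) 𝓛.answer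

/-- **Registered stage-3 stub `stub_clearTransfer` (S) — the clear transfer**, i.e. `ClearTransfer` verbatim:
`obfuscationMonotone_holds` (stage-1 stub 2) then `bestPossibleStep_holds` (stage-1 stub 3), exactly as in the stage-1
composition `KnowledgeOfWalkSplit.WbwObfuscatedGluedTrees_of`, without the split. -/
theorem stub_clearTransfer :
    ∀ (𝓛 : LineData) (ε : ℝ) (O : CircuitObfuscator), 0 < ε → IsSubexpIO ε ppolyCircuits O →
      𝓛.Admissible O → ClauseC 𝓛.gen₀ 𝓛.answer → ClauseC (𝓛.gen O) 𝓛.answer := by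
  intro 𝓛 ε O hε hO hadm c₁
  obtain ⟨hκc, hκlo, hκhi, hh, ⟨q, hq⟩, hpair, ⟨n₀, hcoins⟩⟩ := hadm
  have hq₁ : ∃ q : Polynomial ℕ, ∀ s : List Bool,
      (genClear 𝓛.h 𝓛.m 𝓛.C₁ 𝓛.nm s).length ≤ q.eval s.length :=
    ⟨q, fun s => le_trans (by omega) (hq s)⟩
  have c₂ : ClauseC (genObf O 𝓛.κ 𝓛.h 𝓛.m 𝓛.C₁ 𝓛.nm) 𝓛.answer :=
    obfuscationMonotone_holds O hO.isEfficient 𝓛.κ 𝓛.h 𝓛.m 𝓛.C₁ 𝓛.nm 𝓛.ans hκc hκhi hh hq₁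
      ⟨n₀, fun s hs => (hcoins s hs).2⟩ c₁
  exact bestPossibleStep_holds ε O hε hO 𝓛.κ 𝓛.h 𝓛.m 𝓛.C₀ 𝓛.C₁ 𝓛.nm 𝓛.ans hκlo hκhi hh ⟨q, hq⟩ hpair
    ⟨n₀, hcoins⟩ c₂

/-- `ClearTransfer` holds (it IS the registered stage-3 stub `stub_clearTransfer`). -/
theorem clearTransfer_holds : ClearTransfer := stub_clearTransfer

/-- `KnowledgeTransfer` factors through `ClearTransfer` and the split (consistency with stage 1). -/
theorem knowledgeTransfer_of_clearTransfer (h : ClearTransfer) : KnowledgeTransfer :=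
  fun 𝓛 ε O hε hO hadm hcoh hK hW =>
    h 𝓛 ε O hε hO hadm (splitLemma_holds 𝓛.M 𝓛.gen₀ 𝓛.answer hcoh hK hW)

/-! ## §2 The same on the landed generator -/

/-- **Clear transfer for the landed generator**: for every master datum `D`, reference presentation `Γ₁`, `ε > 0`,
sub-exp iO `O` and PRF scheme `P`, under the definitional side conditions, clause (C) for the clear reference generator
of `Γ₁` implies clause (C) for `(gen D.params O P, ans D.params O P)`. -/
def GeneratorClearTransfer : Prop :=
  ∀ (D : MasterData) (Γ₁ : D.Presentation) (ε : ℝ) (O : CircuitObfuscator) (P : PuncturablePRFScheme),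
    0 < ε → IsSubexpIO ε ppolyCircuits O → GenAdmissible D O P → RefAdmissible D Γ₁ O →
    ClauseC (D.lineData Γ₁ P).gen₀ (D.lineData Γ₁ P).answer →
    ClauseC (gen D.params O P) (ans D.params O P)

/-- `GeneratorClearTransfer` holds: `clearTransfer_holds` on `D.lineData Γ₁ P` (admissible by `stub_admissible`), moved onto
the landed pair by `stub_factorisation` and `stub_transport` — the stage-2 composition without KWA₀/WordHard₀/coherence. -/
theorem generatorClearTransfer_holds : GeneratorClearTransfer := by
  intro D Γ₁ ε O P hε hO hadm href hC₀
  have hC : ClauseC ((D.lineData Γ₁ P).gen O) (D.lineData Γ₁ P).answer :=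
    clearTransfer_holds (D.lineData Γ₁ P) ε O hε hO (stub_admissible D Γ₁ O P hadm href) hC₀
  exact stub_transport _ _ _ _ (stub_factorisation D Γ₁ O P hadm) hC

/-! ## §3 The knowledge-free residual and the typed crux from it -/

/-- **`ClearHardness D O P`** — the crux's residual content WITHOUT the knowledge axiom: SOME admissible reference
presentation `Γ₁` of the neighbour circuits has clause (C) IN THE CLEAR, i.e. no PPT given `⟨1ⁿ, ⟨code of Γ₁ ℓ k,
name_k(ENTRANCE)⟩⟩` outputs `name_k(EXIT)` except with probability decaying superpolynomially on average over the seed.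
Weaker than `ReferenceHardness` (`clearHardness_of_referenceHardness`); it is the best-possible-obfuscation residue of
the crux.  A hypothesis of the route (crux-grade), never a fact. -/
def ClearHardness (D : MasterData) (O : CircuitObfuscator) (P : PuncturablePRFScheme) : Prop :=
  ∃ Γ₁ : D.Presentation, RefAdmissible D Γ₁ O ∧ ClauseC (D.lineData Γ₁ P).gen₀ (D.lineData Γ₁ P).answer

/-- `ReferenceHardness → ClearHardness` under `GenAdmissible` (the split `stub_split`, with coherence from
`stub_coherent`): the knowledge-free residual is implied by the stage-2 residual. -/
theorem clearHardness_of_referenceHardness {D : MasterData} {O : CircuitObfuscator} {P : PuncturablePRFScheme}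
    (hadm : GenAdmissible D O P) (h : ReferenceHardness D O P) : ClearHardness D O P := by
  obtain ⟨Γ₁, href, hK, hW⟩ := h
  exact ⟨Γ₁, href, splitLemma_holds _ _ _ (stub_coherent D Γ₁ O P hadm href) hK hW⟩

/-- Clause (C) for the landed generator at an admissible master datum, from `ClearHardness`. -/
theorem clauseC_of_clearHardness (hGT : GeneratorClearTransfer) (D : MasterData) {ε : ℝ} (hε : 0 < ε)
    {O : CircuitObfuscator} (hO : IsSubexpIO ε ppolyCircuits O) (P : PuncturablePRFScheme)
    (hadm : GenAdmissible D O P) (hCH : ClearHardness D O P) :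
    ClauseC (gen D.params O P) (ans D.params O P) := by
  obtain ⟨Γ₁, href, hC₀⟩ := hCH
  exact hGT D Γ₁ ε O P hε hO hadm href hC₀

/-- **The typed crux with the knowledge-free antecedent** (shape `W` of the three-item glue, with
`AdmC := GenAdmissible ∧ ClearHardness`): at every BPR15 §5.1 parameter point and every admissible master datum whose
neighbour circuits admit SOME white-box-hard presentation in the clear, clause (C) holds for `obfuscatedGluedTreesGen D.params`. -/
def TypedCruxClear : Prop :=
  ∀ ε : ℝ, 0 < ε → ε < 1 → ∀ O : CircuitObfuscator, IsSubexpIO ε ppolyCircuits O →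
    ∀ P : PuncturablePRFScheme, P.inLen = id → P.outLen = id →
      IsTDSecurePuncturablePRF P (fun κ => (2 : ℝ) ^ ((κ : ℝ) ^ ε)) (fun κ => (2 : ℝ) ^ (-((κ : ℝ) ^ ε))) →
    ∀ f : List Bool → List Bool, IsOneWay f → Function.Injective f → ∀ c : ℕ, 1 < (c : ℝ) * ε →
    ∀ D : MasterData, GenAdmissible D O P → ClearHardness D O P →
      ClauseC (obfuscatedGluedTreesGen D.params O P f c).1 (obfuscatedGluedTreesGen D.params O P f c).2

/-- `GeneratorClearTransfer → TypedCruxClear`. -/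
theorem typedCruxClear_of_generatorClearTransfer (hGT : GeneratorClearTransfer) : TypedCruxClear := by
  intro ε hε _ O hO P _ _ _ f _ _ c _ D hadm hCH
  rw [obfuscatedGluedTreesGen_fst, obfuscatedGluedTreesGen_snd]
  exact clauseC_of_clearHardness hGT D hε hO P hadm hCH

/-- **`TypedCruxClear` holds**: if the planner gives the informal item stmt-QuantumAdvantage-2340 this signature, it closes
by this theorem; the residual filed next to it is `ClearHardness` (no knowledge axiom). -/
theorem typedCruxClear_holds : TypedCruxClear := typedCruxClear_of_generatorClearTransfer generatorClearTransfer_holds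

/-- `TypedCruxClear → TypedCrux`: the knowledge-free typing is the STRONGER theorem (its antecedent is weaker). -/
theorem typedCrux_of_typedCruxClear (h : TypedCruxClear) : TypedCrux :=
  fun ε hε hε1 O hO P hPi hPo hP f hf hinj c hc D hadm hRH =>
    h ε hε hε1 O hO P hPi hPo hP f hf hinj c hc D hadm (clearHardness_of_referenceHardness hadm hRH)

/-! ## §4 The route's engine modulo the knowledge-free residual -/

/-- **The residual conjecture of the route after stage 3, knowledge-free**: at every BPR15 §5.1 parameter point some
admissible master datum carries `ClearHardness`, the generator's polynomial-time data and clause (Q). Crux-grade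
(`ClearHardness`); never asserted here. -/
def ResidualConjectureClear : Prop :=
  ∀ ε : ℝ, 0 < ε → ε < 1 → ∀ O : CircuitObfuscator, IsSubexpIO ε ppolyCircuits O →
    ∀ P : PuncturablePRFScheme, P.inLen = id → P.outLen = id →
      IsTDSecurePuncturablePRF P (fun κ => (2 : ℝ) ^ ((κ : ℝ) ^ ε)) (fun κ => (2 : ℝ) ^ (-((κ : ℝ) ^ ε))) →
    ∀ f : List Bool → List Bool, IsOneWay f → Function.Injective f →
    ∃ D : MasterData, GenAdmissible D O P ∧ ClearHardness D O P ∧ FPData D.params O P ∧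
      ∃ F : QCircuitFamily cliffordT, F.IsOracleFree ∧ F.IsUniform ∧
        ∀ s, 2 / 3 ≤ F.kernelProb 0 (gen D.params O P s) {y | ans D.params O P s <+: y}

/-- `ResidualConjecture → ResidualConjectureClear` (the stage-3 residual is weaker). -/
theorem residualConjectureClear_of_residualConjecture (h : ResidualConjecture) : ResidualConjectureClear := by
  intro ε hε hε1 O hO P hPi hPo hP f hf hinj
  obtain ⟨D, hadm, hRH, hFP, hQ⟩ := h ε hε hε1 O hO P hPi hPo hP f hf hinj
  exact ⟨D, hadm, clearHardness_of_referenceHardness hadm hRH, hFP, hQ⟩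

/-- **`WbwEngine` from the knowledge-free residual** (the landed glue `wbwEngine_of_obfuscatedGluedTreesGen` with
`Λ := D.params`, clause (C) by `generatorClearTransfer_holds`). -/
theorem wbwEngine_of_residualConjectureClear (hR : ResidualConjectureClear) :
    Summit.QuantumAdvantage.QuantumAdvantage.Theses.WhiteBoxWalk.WbwEngine := by
  refine Summit.QuantumAdvantage.QuantumAdvantage.Theorems.WhiteBoxWalk.wbwEngine_of_obfuscatedGluedTreesGen ?_
  intro ε hε hε1 O hO P hPin hPout hP f hf hinj
  obtain ⟨D, hadm, hCH, hFP, hQ⟩ := hR ε hε hε1 O hO P hPin hPout hP f hf hinj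
  exact ⟨D.params, hFP, hQ, clauseC_of_clearHardness generatorClearTransfer_holds D hε hO P hadm hCH⟩

end Summit.QuantumAdvantage.QuantumAdvantage.Cruxes.WbwObfuscatedGluedTrees.KnowledgeOfWalkSplit.Generator
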